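import Literature.AlgebraicGeometry.Resolution.QuasiRegularSequences
import Literature.AlgebraicGeometry.Resolution.CobordantBlowupFiltration
import Mathlib.RingTheory.MvPolynomial.Ideal
import HarnessLib

/-!
# Weighted monomial ideals in a quasi-regular sequence are primary (no embedded components)

Route `ResolutionOfSingularities/WeightedInvariant`, door crux `HypersurfaceCentreConstruction`
(stmt-ResolutionOfSingularities-19897) — OURS, a helper (summit-side because the weighted form is not a printed
statement).  Support lemma for the weighted-centre calculus of the
cobordant blow-up (Włodarczyk 2022, Lemma 2.1.9: the pieces `𝒥ₙ = (u^α : Σ αᵢ wᵢ ≥ n)` of the Rees algebra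
of a regular weighted centre `(u₁^{1/w₁}, …, u_m^{1/w_m})`, tree `weightedMonomials` /
`weightedFiltration`, `CobordantBlowupFiltration.lean`) and for the e-ladder of the door
`HypersurfaceCentreConstruction` of route `ResolutionOfSingularities/WeightedInvariant` (cell res-hironaka,
`res-L1-w43-stub-10`, plan lemma L3: «a weighted-chart piece is `(u)`-primary, hence determined by its germ
at the generic point of `V(u)`»).

For a QUASI-REGULAR family `u : ι → R` (Matsumura §16; tree `IsQuasiRegular`, e.g. a regular sequence,
`isQuasiRegular_of_isWeaklyRegular`) with `I = (u)` and positive weights `w`: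

this file (part 1 of 2) sets up the dictionary between `𝒥ₙ` and the monomial ideal `(X^α : weight α ≥ n)` of
the polynomial ring (`map_eval_span_monomial_weight`, `mem_span_monomial_weight_iff`), the sandwich
`Iⁿ ⊆ 𝒥ₙ ⊆ I ⊆ √𝒥ₙ` (`span_pow_le_span_weightedMonomials`, `span_weightedMonomials_le_span`,
`radical_span_weightedMonomials`), and the two quasi-regularity tools: `exists_lift_form` (a degree-`d` form of
weight `≥ n` evaluating into `I^{d+1}` can be replaced by a degree-`(d+1)` form of weight `≥ n`) and
`exists_form_of_mem_span_weightedMonomials` (normal form of `𝒥ₙ ∩ Iˢ` modulo higher degree).  Part 2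
(`Theorems/WeightedInvariantQuasiRegularWeightedMonomialsPrimary.lean`) proves the colon property
`(𝒥ₙ : a) = 𝒥ₙ` for `(I : a) = I` (weighted Matsumura 16.2 (ii)) and that `𝒥ₙ` is `I`-primary when `I` is
prime.  Pure commutative algebra on Mathlib's `MvPolynomial`; no named facts.
[cite: Matsumura1987, Thm. 16.2; Wlodarczyk2022, Lemma 2.1.9]
-/

noncomputable section

set_option linter.dupNamespace false -- mandated namespace of this single-conjunct summit

namespace Summit.ResolutionOfSingularities.ResolutionOfSingularities.Theorems

universe u v

open MvPolynomial Literature.AlgebraicGeometry.Resolution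

variable {R : Type u} [CommRing R] {ι : Type v} (u : ι → R) (w : ι → ℕ)

/-! ## The monomial ideal of weight `≥ n` in the polynomial ring and its evaluation -/

/-- Evaluating the monomial `X^α` at `u` gives `u^α`. [folklore] -/
theorem eval_monomial_one (α : ι →₀ ℕ) :
    eval u (monomial α (1 : R)) = α.prod (fun i e => u i ^ e) := by
  rw [eval_monomial, one_mul]

/-- Membership in the monomial ideal `(X^α : n ≤ weight α)` of `R[X]` is read on the support: every
exponent in the support has weight `≥ n` (the generating set of exponents is upward closed). [folklore] -/
theorem mem_span_monomial_weight_iff (n : ℕ) (F : MvPolynomial ι R) :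
    F ∈ Ideal.span ((fun α => monomial α (1 : R)) '' {α | n ≤ Finsupp.weight w α}) ↔
      ∀ α ∈ F.support, n ≤ Finsupp.weight w α := by
  rw [mem_ideal_span_monomial_image]
  refine forall₂_congr fun α _ => ⟨?_, fun h => ⟨α, h, le_rfl⟩⟩
  rintro ⟨β, hβ, hβα⟩
  obtain ⟨γ, rfl⟩ := exists_add_of_le hβα
  rw [map_add]
  exact hβ.trans (Nat.le_add_right _ _)

/-- The image under `eval u` of the monomial ideal `(X^α : n ≤ weight α)` is `𝒥ₙ = (u^α : n ≤ weight α)`.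
[folklore] -/
theorem map_eval_span_monomial_weight (n : ℕ) :
    Ideal.map (eval u) (Ideal.span ((fun α => monomial α (1 : R)) '' {α | n ≤ Finsupp.weight w α})) =
      Ideal.span (weightedMonomials u w n) := by
  rw [Ideal.map_span]
  congr 1
  ext x
  constructor
  · rintro ⟨_, ⟨α, hα, rfl⟩, rfl⟩
    exact ⟨α, hα, (eval_monomial_one u α).symm⟩
  · rintro ⟨α, hα, rfl⟩
    exact ⟨monomial α 1, ⟨α, hα, rfl⟩, eval_monomial_one u α⟩

/-- A polynomial in the monomial ideal of weight `≥ n` evaluates into `𝒥ₙ`. [folklore] -/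
theorem eval_mem_span_weightedMonomials {n : ℕ} {F : MvPolynomial ι R}
    (hF : F ∈ Ideal.span ((fun α => monomial α (1 : R)) '' {α | n ≤ Finsupp.weight w α})) :
    eval u F ∈ Ideal.span (weightedMonomials u w n) := by
  rw [← map_eval_span_monomial_weight u w n]
  exact Ideal.mem_map_of_mem _ hF

/-- Every element of `𝒥ₙ` is `P(u)` for some `P` in the monomial ideal of weight `≥ n`. [folklore] -/
theorem exists_eval_eq_of_mem_span_weightedMonomials {n : ℕ} {y : R}
    (hy : y ∈ Ideal.span (weightedMonomials u w n)) :
    ∃ P ∈ Ideal.span ((fun α => monomial α (1 : R)) '' {α | n ≤ Finsupp.weight w α}), eval u P = y := by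
  rw [← map_eval_span_monomial_weight u w n] at hy
  exact (Ideal.mem_map_iff_of_surjective (eval u) fun r => ⟨C r, eval_C r⟩).mp hy

/-- Homogeneous components of a member of the monomial ideal of weight `≥ n` are members. [folklore] -/
theorem homogeneousComponent_mem_span_monomial_weight {n : ℕ} {P : MvPolynomial ι R}
    (hP : P ∈ Ideal.span ((fun α => monomial α (1 : R)) '' {α | n ≤ Finsupp.weight w α})) (d : ℕ) :
    homogeneousComponent d P ∈
      Ideal.span ((fun α => monomial α (1 : R)) '' {α | n ≤ Finsupp.weight w α}) := by
  rw [mem_span_monomial_weight_iff] at hP ⊢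
  intro α hα
  rw [mem_support_iff, coeff_homogeneousComponent] at hα
  by_cases h : α.degree = d
  · rw [if_pos h] at hα
    exact hP α (mem_support_iff.mpr hα)
  · rw [if_neg h] at hα
    exact absurd rfl hα

/-- The degree of an exponent is at most its weight when all weights are positive. [folklore] -/
theorem degree_le_weight (hw : ∀ i, 0 < w i) (α : ι →₀ ℕ) : α.degree ≤ Finsupp.weight w α := by
  rw [Finsupp.degree_eq_weight_one, Finsupp.weight_apply, Finsupp.weight_apply]
  exact Finset.sum_le_sum fun i _ => by
    simp only [smul_eq_mul, mul_one]
    exact Nat.le_mul_of_pos_right _ (hw i)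

/-- With positive weights, `Iˢ ⊆ 𝒥ₙ` for `n ≤ s` (a monomial of degree `s` has weight `≥ s`). [folklore] -/
theorem span_pow_le_span_weightedMonomials (hw : ∀ i, 0 < w i) {n s : ℕ} (hns : n ≤ s) :
    Ideal.span (Set.range u) ^ s ≤ Ideal.span (weightedMonomials u w n) := by
  intro y hy
  obtain ⟨F, hF, rfl⟩ := exists_isHomogeneous_of_mem_span_pow u s hy
  refine eval_mem_span_weightedMonomials u w ((mem_span_monomial_weight_iff w n F).mpr ?_)
  intro α hα
  have hdeg : α.degree = s := by
    rw [Finsupp.degree_eq_weight_one]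
    exact hF (mem_support_iff.mp hα)
  exact hns.trans (hdeg ▸ degree_le_weight w hw α)

/-! ## `𝒥ₙ` sits between `Iⁿ` and `I` -/

/-- `𝒥ₙ ⊆ I` for `n ≥ 1` (every generator has a variable of positive exponent). [folklore] -/
theorem span_weightedMonomials_le_span {n : ℕ} (hn : 1 ≤ n) :
    Ideal.span (weightedMonomials u w n) ≤ Ideal.span (Set.range u) := by
  classical
  refine Ideal.span_le.mpr ?_
  rintro _ ⟨α, hα, rfl⟩
  -- some exponent is positive
  have hne : α ≠ 0 := by
    rintro rfl
    rw [map_zero] at hα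
    exact Nat.not_succ_le_zero 0 (hn.trans hα)
  obtain ⟨i, hi⟩ := Finsupp.ne_iff.mp hne
  rw [Finsupp.zero_apply] at hi
  have hmem : i ∈ α.support := Finsupp.mem_support_iff.mpr hi
  rw [Finsupp.prod, ← Finset.mul_prod_erase _ _ hmem]
  refine Ideal.mul_mem_right _ _ ?_
  obtain ⟨k, hk⟩ := Nat.exists_eq_succ_of_ne_zero hi
  rw [hk, pow_succ]
  exact Ideal.mul_mem_left _ _ (Ideal.subset_span ⟨i, rfl⟩)

/-- `I ⊆ √𝒥ₙ` when the weights are positive (`uᵢⁿ ∈ 𝒥ₙ`). [folklore] -/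
theorem span_le_radical_span_weightedMonomials (hw : ∀ i, 0 < w i) (n : ℕ) :
    Ideal.span (Set.range u) ≤ (Ideal.span (weightedMonomials u w n)).radical := by
  refine Ideal.span_le.mpr ?_
  rintro _ ⟨i, rfl⟩
  refine ⟨n, Ideal.subset_span ⟨Finsupp.single i n, ?_, ?_⟩⟩
  · rw [Finsupp.weight_apply, Finsupp.sum_single_index (zero_smul ℕ (w i)), smul_eq_mul]
    exact Nat.le_mul_of_pos_right n (hw i)
  · rw [Finsupp.prod_single_index]
    exact pow_zero _

/-- **The radical of `𝒥ₙ` is `I`** for `n ≥ 1`, positive weights and `I` radical (e.g. prime). [folklore] -/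
theorem radical_span_weightedMonomials (hw : ∀ i, 0 < w i) {n : ℕ} (hn : 1 ≤ n)
    (hI : (Ideal.span (Set.range u)).IsRadical) :
    (Ideal.span (weightedMonomials u w n)).radical = Ideal.span (Set.range u) :=
  le_antisymm (hI.radical_le_iff.mpr (span_weightedMonomials_le_span u w hn))
    ((span_le_radical_span_weightedMonomials u w hw n).trans le_rfl)

/-! ## Raising the degree of a form by quasi-regularity -/

section QuasiRegular

variable [Fintype ι]

/-- **Degree raising.** If `u` is quasi-regular, `H` is a form of degree `d` in the monomial ideal of weight
`≥ n`, and `H(u) ∈ I^{d+1}`, then `H(u) = H′(u)` for a form `H′` of degree `d + 1` in the same monomial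
ideal: by quasi-regularity every coefficient of `H` lies in `I = (u)`, `c_α = Σᵢ c_{α,i} uᵢ`, and
`H′ := Σ_α Σᵢ c_{α,i} X^{α + eᵢ}` (weights only grow). [folklore] -/
theorem exists_lift_form (hu : IsQuasiRegular u) {n d : ℕ} {H : MvPolynomial ι R}
    (hH : H.IsHomogeneous d)
    (hHn : H ∈ Ideal.span ((fun α => monomial α (1 : R)) '' {α | n ≤ Finsupp.weight w α}))
    (hHd : eval u H ∈ Ideal.span (Set.range u) ^ (d + 1)) :
    ∃ H' : MvPolynomial ι R, H'.IsHomogeneous (d + 1) ∧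
      H' ∈ Ideal.span ((fun α => monomial α (1 : R)) '' {α | n ≤ Finsupp.weight w α}) ∧
      eval u H' = eval u H := by
  -- coefficients of `H` lie in `I = (u)`: write them on the generators
  have hcoeff : ∀ α, H.coeff α ∈ Ideal.span (Set.range u) := (isQuasiRegular_def u).mp hu d H hH hHd
  choose c hc using fun α => Ideal.mem_span_range_iff_exists_fun.mp (hcoeff α)
  refine ⟨∑ α ∈ H.support, ∑ i, monomial (α + Finsupp.single i 1) (c α i), ?_, ?_, ?_⟩
  · -- homogeneous of degree `d + 1`
    rw [← mem_homogeneousSubmodule]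
    refine Submodule.sum_mem _ fun α hα => Submodule.sum_mem _ fun i _ => ?_
    rw [mem_homogeneousSubmodule]
    refine isHomogeneous_monomial _ ?_
    have hdeg : α.degree = d := by
      rw [Finsupp.degree_eq_weight_one]
      exact hH (mem_support_iff.mp hα)
    rw [map_add, hdeg, Finsupp.degree_single]
  · -- in the monomial ideal of weight `≥ n`
    rw [mem_span_monomial_weight_iff] at hHn
    refine Ideal.sum_mem _ fun α hα => Ideal.sum_mem _ fun i _ => ?_
    have hgen : monomial α (1 : R) ∈
        Ideal.span ((fun α => monomial α (1 : R)) '' {α | n ≤ Finsupp.weight w α}) :=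
      Ideal.subset_span ⟨α, hHn α hα, rfl⟩
    have : monomial (α + Finsupp.single i 1) (c α i) =
        monomial (Finsupp.single i 1) (c α i) * monomial α (1 : R) := by
      rw [monomial_mul, mul_one, add_comm]
    rw [this]
    exact Ideal.mul_mem_left _ _ hgen
  · -- same evaluation
    have hsingle : ∀ i, (Finsupp.single i 1).prod (fun i e => u i ^ e) = u i := fun i => by
      rw [Finsupp.prod_single_index]
      · exact pow_one _
      · exact pow_zero _
    rw [map_sum]
    conv_rhs => rw [H.as_sum, map_sum]
    refine Finset.sum_congr rfl fun α _ => ?_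
    rw [map_sum, eval_monomial]
    simp_rw [eval_monomial, prod_pow_add u, hsingle]
    rw [← hc α, Finset.sum_mul]
    refine Finset.sum_congr rfl fun i _ => ?_
    ring

/-- **Normal form of `𝒥ₙ ∩ Iˢ` modulo higher degree.** If `u` is quasi-regular and `y ∈ 𝒥ₙ ∩ Iˢ`, then for
every `e ≤ s` there is `P` in the monomial ideal of weight `≥ n` with `P(u) = y` and NO homogeneous
component of degree `< e` (induction on `e`: the lowest component evaluates into `I^{e+1}` because `y` and
all higher components do, so it can be raised by `exists_lift_form`). [folklore] -/
theorem exists_form_of_mem_span_weightedMonomials (hu : IsQuasiRegular u) {n s : ℕ} {y : R}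
    (hy : y ∈ Ideal.span (weightedMonomials u w n)) (hys : y ∈ Ideal.span (Set.range u) ^ s) :
    ∀ e ≤ s, ∃ P ∈ Ideal.span ((fun α => monomial α (1 : R)) '' {α | n ≤ Finsupp.weight w α}),
      eval u P = y ∧ ∀ d < e, homogeneousComponent d P = 0 := by
  intro e
  induction e with
  | zero =>
    intro _
    obtain ⟨P, hP, hPy⟩ := exists_eval_eq_of_mem_span_weightedMonomials u w hy
    exact ⟨P, hP, hPy, fun d hd => absurd hd (Nat.not_lt_zero d)⟩
  | succ e ih =>
    intro hes
    obtain ⟨P, hP, hPy, hP0⟩ := ih (Nat.le_of_succ_le hes)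
    -- the degree-`e` component evaluates into `I^{e+1}`
    set Pe := homogeneousComponent e P with hPe_def
    have hPe : Pe.IsHomogeneous e := homogeneousComponent_isHomogeneous e P
    have hPen : Pe ∈ Ideal.span ((fun α => monomial α (1 : R)) '' {α | n ≤ Finsupp.weight w α}) :=
      homogeneousComponent_mem_span_monomial_weight w hP e
    have hsum : ∑ i ∈ Finset.range (P.totalDegree + 1), eval u (homogeneousComponent i P) = y := by
      rw [← map_sum, sum_homogeneousComponent, hPy]
    have hothers : ∀ i ∈ Finset.range (P.totalDegree + 1), i ≠ e →
        eval u (homogeneousComponent i P) ∈ Ideal.span (Set.range u) ^ (e + 1) := by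
      intro i _ hie
      rcases lt_or_gt_of_ne hie with hlt | hgt
      · rw [hP0 i hlt, map_zero]
        exact Ideal.zero_mem _
      · exact Ideal.pow_le_pow_right hgt (eval_mem_span_pow u (homogeneousComponent_isHomogeneous i P))
    have hPeval : eval u Pe ∈ Ideal.span (Set.range u) ^ (e + 1) := by
      by_cases he : e ∈ Finset.range (P.totalDegree + 1)
      · have hsplit := Finset.add_sum_erase (Finset.range (P.totalDegree + 1))
          (fun i => eval u (homogeneousComponent i P)) he
        rw [hsum] at hsplit
        have hrest : ∑ i ∈ (Finset.range (P.totalDegree + 1)).erase e,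
            eval u (homogeneousComponent i P) ∈ Ideal.span (Set.range u) ^ (e + 1) :=
          Ideal.sum_mem _ fun i hi =>
            hothers i (Finset.mem_of_mem_erase hi) (Finset.ne_of_mem_erase hi)
        have : eval u Pe = y - ∑ i ∈ (Finset.range (P.totalDegree + 1)).erase e,
            eval u (homogeneousComponent i P) := by
          rw [hPe_def, ← hsplit, add_sub_cancel_right]
        rw [this]
        exact Ideal.sub_mem _ (Ideal.pow_le_pow_right hes hys) hrest
      · rw [Finset.mem_range, not_lt] at he
        rw [hPe_def, homogeneousComponent_eq_zero _ _ (Nat.lt_of_succ_le he), map_zero]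
        exact Ideal.zero_mem _
    -- raise it to degree `e + 1`
    obtain ⟨Pe', hPe', hPe'n, hPe'eval⟩ := exists_lift_form u w hu hPe hPen hPeval
    refine ⟨P - Pe + Pe', ?_, ?_, ?_⟩
    · exact Ideal.add_mem _ (Ideal.sub_mem _ hP hPen) hPe'n
    · rw [map_add, map_sub, hPe'eval, sub_add_cancel, hPy]
    · intro d hd
      rw [map_add, map_sub, homogeneousComponent_of_mem hPe, homogeneousComponent_of_mem hPe']
      rcases Nat.lt_succ_iff_lt_or_eq.mp hd with hlt | rfl
      · rw [hP0 d hlt, if_neg (Nat.ne_of_lt hlt), if_neg (Nat.ne_of_lt (Nat.lt_succ_of_lt hlt))]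
        simp
      · rw [if_pos rfl, if_neg (Nat.ne_of_lt (Nat.lt_succ_self d)), ← hPe_def]
        simp

end QuasiRegular

end Summit.ResolutionOfSingularities.ResolutionOfSingularities.Theorems

end
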